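import Literature.Computability.Learning.LearnerAnalysis
import Mathlib.Analysis.Complex.ExponentialBounds
import HarnessLib

/-!
# The analytic inequalities behind the learner's parameters

Analysis instalment (M9b-1) of the decomposition of the named fact
`Literature.Computability.Learning.cikk_natural_implies_learning` (CIKK 2016, Thm. 5.1): for every
level `ℓ` and `1 ≤ a, b` with `a, b < 2^s` (`s = prmS n a b`), the parameters of
`LearnerParamsFP.lean` satisfy the hypotheses `hGL`, `H1u`, `H2u`, `H3u` of `card_goodRun_ge`
with `δ₁ = 1/(2a)`, the repetition bound `(1 - p₀)^{Reps} ≤ 1/(4b)` and the validation bound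
`Σ_{ℓ ≤ ℓg} Reps(ℓ)·2e^{-2m(ℓ)/(16a²)} ≤ 1/(4b)`. Technique: `e^{-x} ≤ 2^{-m}` for `m ≤ x`, and
then pure power-of-two bookkeeping.

## References

* M. Carmosino, R. Impagliazzo, V. Kabanets, A. Kolokolova, *Learning algorithms from natural
  proofs*, CCC 2016, §5 (parameters) [CarmosinoImpagliazzoKabanetsKolokolova2016].
-/

namespace Literature.Computability.Learning

open Real Finset

/-! ### Tools -/

/-- `e^{-x} ≤ (1/2)^m` whenever `m ≤ x`. [folklore] -/
theorem exp_neg_le_half_pow {x : ℝ} {m : ℕ} (h : (m : ℝ) ≤ x) : Real.exp (-x) ≤ (1 / 2) ^ m := by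
  have h2 : (2 : ℝ) ^ m ≤ Real.exp m := by
    rw [← mul_one (m : ℝ), Real.exp_nat_mul]
    exact pow_le_pow_left₀ (by norm_num) Real.exp_one_gt_two.le m
  have hm : Real.exp m ≤ Real.exp x := Real.exp_le_exp.2 h
  rw [Real.exp_neg, one_div, inv_pow]
  exact inv_anti₀ (pow_pos two_pos m) (h2.trans hm)

/-- `(1/2)^m ≤ Y` whenever `1 ≤ 2^m · Y`. [folklore] -/
theorem half_pow_le {m : ℕ} {Y : ℝ} (h : 1 ≤ 2 ^ m * Y) : (1 / 2 : ℝ) ^ m ≤ Y := by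
  rw [one_div, inv_pow, inv_le_iff_one_le_mul₀ (pow_pos two_pos m)]
  linarith [mul_comm ((2:ℝ) ^ m) Y]

/-- **`e^{-x} ≤ Y` from `m ≤ x` and `1 ≤ 2^m Y`.** [folklore] -/
theorem exp_neg_le_of {x Y : ℝ} (m : ℕ) (hx : (m : ℝ) ≤ x) (hY : 1 ≤ 2 ^ m * Y) : Real.exp (-x) ≤ Y :=
  (exp_neg_le_half_pow hx).trans (half_pow_le hY)

/-- `1 + j ≤ 2^j`. [folklore] -/
theorem succ_le_two_pow' (j : ℕ) : j + 1 ≤ 2 ^ j := Nat.lt_two_pow_self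

/-- `ℓ + 1 ≤ 2^{size ℓ}`. [folklore] -/
theorem succ_le_two_pow_size (ℓ : ℕ) : ℓ + 1 ≤ 2 ^ Nat.size ℓ := Nat.lt_size_self ℓ

section Level

variable (n a b ℓ : ℕ)

/-- `k = 2^κ` as a real number. [folklore] -/
theorem lvlK_real : (lvlK n a b ℓ : ℝ) = 2 ^ prmKappa (prmS n a b) ℓ := by
  rw [lvlK, prmK]; push_cast; ring

/-- `2^kk = 256·k·4^ℓ`. [folklore] -/
theorem two_pow_prmKK : (2 : ℝ) ^ prmKK (prmS n a b) ℓ = 256 * lvlK n a b ℓ * 4 ^ ℓ := by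
  rw [lvlK_real, prmKK, pow_add, pow_add, show (4 : ℝ) = 2 ^ 2 by norm_num, ← pow_mul, show (256 : ℝ) = 2 ^ 8 by norm_num]
  ring

/-- **`hGL`**: `k ≤ 2(η/2)²(2^kk - 1)`. [cite: CarmosinoImpagliazzoKabanetsKolokolova2016, §5] -/
theorem hGL_holds : (lvlK n a b ℓ : ℝ) ≤ 2 * (1 / (10 * (2 ^ ℓ : ℕ)) / 2) ^ 2 * (2 ^ prmKK (prmS n a b) ℓ - 1 : ℕ) := by
  have hK : (1 : ℝ) ≤ lvlK n a b ℓ := by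
    have := lvlK_pos n a b ℓ
    exact_mod_cast this
  have hkk : (1 : ℕ) ≤ 2 ^ prmKK (prmS n a b) ℓ := Nat.one_le_two_pow
  have hKK := two_pow_prmKK n a b ℓ
  rw [Nat.cast_sub hkk, Nat.cast_pow, Nat.cast_pow, Nat.cast_ofNat, Nat.cast_one, hKK,
    show (4 : ℝ) ^ ℓ = 2 ^ ℓ * 2 ^ ℓ by rw [← mul_pow]; norm_num]
  have h2 : (1 : ℝ) ≤ 2 ^ ℓ := one_le_pow₀ (by norm_num)
  generalize (lvlK n a b ℓ : ℝ) = K at hK ⊢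
  generalize (2 : ℝ) ^ ℓ = L at h2 ⊢
  have hL : 0 < L := by linarith
  rw [show 2 * (1 / (10 * L) / 2) ^ 2 * (256 * K * (L * L) - 1) = (256 * K * (L * L) - 1) / (200 * (L * L)) by
    field_simp; ring]
  rw [le_div_iff₀ (by positivity)]
  nlinarith [mul_pos hL hL, hK]

/-- The scale facts: `1 ≤ a`, `a < 2^s`. [folklore] -/
theorem a_lt_two_pow_prmS : a < 2 ^ prmS n a b := by
  rw [prmS]; exact lt_of_le_of_lt (by omega) (Nat.lt_size_self (n + a + b + 2))

/-- `b < 2^s`. [folklore] -/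
theorem b_lt_two_pow_prmS : b < 2 ^ prmS n a b := by
  rw [prmS]; exact lt_of_le_of_lt (by omega) (Nat.lt_size_self (n + a + b + 2))

/-- Bookkeeping: `(106 + 7s + 8ℓ) ≤ 2^{7 + s + size ℓ}`. [folklore] -/
theorem lin_le_two_pow (s ℓ : ℕ) : 106 + 7 * s + 8 * ℓ ≤ 2 ^ (7 + s + Nat.size ℓ) := by
  have h1 := succ_le_two_pow' s
  have h2 := succ_le_two_pow_size ℓ
  calc 106 + 7 * s + 8 * ℓ ≤ 106 * ((s + 1) * (ℓ + 1)) := by nlinarith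
    _ ≤ 2 ^ 7 * (2 ^ s * 2 ^ Nat.size ℓ) := Nat.mul_le_mul (by norm_num) (Nat.mul_le_mul h1 h2)
    _ = 2 ^ (7 + s + Nat.size ℓ) := by rw [pow_add, pow_add, Nat.mul_assoc]

/-- **`H1u`** with `δ₁ = 1/(2a)`. [cite: CarmosinoImpagliazzoKabanetsKolokolova2016, §5] -/
theorem H1u_holds (ha : 1 ≤ a) :
    Real.exp (-(3 * (1 / (2 * a)) * lvlK n a b ℓ / 2048)) ≤
      (1 / (10 * (2 ^ ℓ : ℕ)) / (4 * 2 ^ prmKK (prmS n a b) ℓ)) ^ 2 * (1 / (2 * a)) / 4096 := by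
  obtain ⟨s, hs⟩ : ∃ s, prmS n a b = s := ⟨_, rfl⟩
  obtain ⟨κ, hκdef⟩ : ∃ κ, 3 * s + Nat.size ℓ + 30 = κ := ⟨_, rfl⟩
  have hkk : prmKK s ℓ = κ + 2 * ℓ + 8 := by rw [prmKK, prmKappa, hκdef]
  have hKn : lvlK n a b ℓ = 2 ^ κ := by rw [lvlK, prmK, prmKappa, hs, hκdef]
  have has : a < 2 ^ s := hs ▸ a_lt_two_pow_prmS n a b
  have ha' : (0 : ℝ) < a := by exact_mod_cast ha
  rw [hs]
  obtain ⟨m₁, hm₁⟩ : ∃ m, 44 + s + 6 * ℓ + 2 * κ = m := ⟨_, rfl⟩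
  apply exp_neg_le_of m₁
  · -- `m₁ ≤ 3k/(4096a)`
    have hnat : 4096 * a * m₁ ≤ 3 * 2 ^ κ := by
      have hlin : m₁ ≤ 2 ^ (7 + s + Nat.size ℓ) := by
        have := lin_le_two_pow s ℓ
        have : Nat.size ℓ ≤ ℓ + 1 := Nat.size_le.2 (lt_of_lt_of_le Nat.lt_two_pow_self (Nat.pow_le_pow_right (by norm_num) (Nat.le_succ ℓ)))
        rw [← hm₁, ← hκdef]; omega
      calc 4096 * a * m₁ ≤ 2 ^ 12 * 2 ^ s * 2 ^ (7 + s + Nat.size ℓ) := by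
            have h12 : (4096 : ℕ) = 2 ^ 12 := by norm_num
            have : 4096 * a ≤ 2 ^ 12 * 2 ^ s := by rw [← h12]; exact Nat.mul_le_mul_left _ has.le
            exact Nat.mul_le_mul this hlin
        _ = 2 ^ (19 + 2 * s + Nat.size ℓ) := by
            rw [← pow_add, ← pow_add]; exact congrArg (fun e => 2 ^ e) (by omega)
        _ ≤ 2 ^ κ := Nat.pow_le_pow_right (by norm_num) (by rw [← hκdef]; omega)
        _ ≤ 3 * 2 ^ κ := Nat.le_mul_of_pos_left _ (by norm_num)
    have hR : (4096 * a * m₁ : ℝ) ≤ 3 * 2 ^ κ := by exact_mod_cast hnat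
    rw [hKn]; push_cast
    rw [show 3 * (1 / (2 * (a : ℝ))) * 2 ^ κ / 2048 = 3 * 2 ^ κ / (4096 * a) by field_simp; ring, le_div_iff₀ (by positivity)]
    linarith
  · -- `1 ≤ 2^{m₁} · Y₁`
    have hnat : 13107200 * a * 4 ^ ℓ * 4 ^ prmKK s ℓ ≤ 2 ^ m₁ := by
      calc 13107200 * a * 4 ^ ℓ * 4 ^ prmKK s ℓ ≤ 2 ^ 24 * 2 ^ s * 2 ^ (2 * ℓ) * 2 ^ (2 * prmKK s ℓ) := by
            rw [pow_mul, pow_mul, show (2 : ℕ) ^ 2 = 4 by norm_num]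
            exact Nat.mul_le_mul (Nat.mul_le_mul (Nat.mul_le_mul (by norm_num) has.le) le_rfl) le_rfl
        _ = 2 ^ (24 + s + 2 * ℓ + 2 * prmKK s ℓ) := by
            rw [← pow_add, ← pow_add, ← pow_add]
        _ ≤ 2 ^ m₁ := Nat.pow_le_pow_right (by norm_num) (by rw [hkk, ← hm₁]; omega)
    have hR : (13107200 * a * 4 ^ ℓ * 4 ^ prmKK s ℓ : ℝ) ≤ 2 ^ m₁ := by exact_mod_cast hnat
    push_cast
    have hpos : (0 : ℝ) < 13107200 * a * 4 ^ ℓ * 4 ^ prmKK s ℓ := by positivity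
    rw [show (1 / (10 * (2 : ℝ) ^ ℓ) / (4 * 2 ^ prmKK s ℓ)) ^ 2 * (1 / (2 * a)) / 4096 =
      1 / (13107200 * a * 4 ^ ℓ * 4 ^ prmKK s ℓ) by
        rw [show (4 : ℝ) ^ ℓ = (2 ^ ℓ) ^ 2 by rw [← pow_mul, mul_comm, pow_mul]; norm_num,
          show (4 : ℝ) ^ prmKK s ℓ = (2 ^ prmKK s ℓ) ^ 2 by rw [← pow_mul, mul_comm, pow_mul]; norm_num]
        field_simp; ring]
    rw [mul_one_div, le_div_iff₀ hpos, one_mul]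
    exact hR

/-- **`H2u`** with `δ₁ = 1/(2a)`. [cite: CarmosinoImpagliazzoKabanetsKolokolova2016, §5] -/
theorem H2u_holds (ha : 1 ≤ a) :
    Real.exp (-(lvlK n a b ℓ * (1 / (2 * a)) ^ 2 / 2048)) ≤ 1 / (10 * (2 ^ ℓ : ℕ)) / (4 * 2 ^ prmKK (prmS n a b) ℓ) / 4 := by
  obtain ⟨s, hs⟩ : ∃ s, prmS n a b = s := ⟨_, rfl⟩
  obtain ⟨κ, hκdef⟩ : ∃ κ, 3 * s + Nat.size ℓ + 30 = κ := ⟨_, rfl⟩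
  have hkk : prmKK s ℓ = κ + 2 * ℓ + 8 := by rw [prmKK, prmKappa, hκdef]
  have hKn : lvlK n a b ℓ = 2 ^ κ := by rw [lvlK, prmK, prmKappa, hs, hκdef]
  have has : a < 2 ^ s := hs ▸ a_lt_two_pow_prmS n a b
  have ha' : (0 : ℝ) < a := by exact_mod_cast ha
  rw [hs]
  obtain ⟨m₂, hm₂⟩ : ∃ m, 8 + ℓ + prmKK s ℓ = m := ⟨_, rfl⟩
  apply exp_neg_le_of m₂
  · -- `m₂ ≤ k/(8192a²)`
    have hnat : 8192 * (a * a) * m₂ ≤ 2 ^ κ := by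
      have hlin : m₂ ≤ 2 ^ (6 + s + Nat.size ℓ) := by
        have h1 := succ_le_two_pow' s
        have h2 := succ_le_two_pow_size ℓ
        have : Nat.size ℓ ≤ ℓ + 1 := Nat.size_le.2 (lt_of_lt_of_le Nat.lt_two_pow_self (Nat.pow_le_pow_right (by norm_num) (Nat.le_succ ℓ)))
        have hprod : (s + 1) * (ℓ + 1) = s * ℓ + s + ℓ + 1 := by ring
        calc m₂ ≤ 47 * ((s + 1) * (ℓ + 1)) := by rw [← hm₂, hkk, ← hκdef, hprod]; generalize s * ℓ = z; omega
          _ ≤ 2 ^ 6 * (2 ^ s * 2 ^ Nat.size ℓ) := Nat.mul_le_mul (by norm_num) (Nat.mul_le_mul h1 h2)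
          _ = 2 ^ (6 + s + Nat.size ℓ) := by rw [pow_add, pow_add, Nat.mul_assoc]
      have haa : a * a ≤ 2 ^ s * 2 ^ s := Nat.mul_le_mul has.le has.le
      have h13 : (8192 : ℕ) = 2 ^ 13 := by norm_num
      calc 8192 * (a * a) * m₂ ≤ 2 ^ 13 * (2 ^ s * 2 ^ s) * 2 ^ (6 + s + Nat.size ℓ) := by
            rw [← h13]; exact Nat.mul_le_mul (Nat.mul_le_mul_left _ haa) hlin
        _ = 2 ^ (19 + 3 * s + Nat.size ℓ) := by
            rw [← pow_add, ← pow_add, ← pow_add]; exact congrArg (fun e => 2 ^ e) (by omega)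
        _ ≤ 2 ^ κ := Nat.pow_le_pow_right (by norm_num) (by rw [← hκdef]; omega)
    have hR : (8192 * (a * a) * m₂ : ℝ) ≤ 2 ^ κ := by exact_mod_cast hnat
    rw [hKn]; push_cast
    rw [show (2 : ℝ) ^ κ * (1 / (2 * a)) ^ 2 / 2048 = 2 ^ κ / (8192 * (a * a)) by field_simp; ring, le_div_iff₀ (by positivity)]
    linarith
  · -- `1 ≤ 2^{m₂} · Y₂`
    have hnat : 160 * 2 ^ ℓ * 2 ^ prmKK s ℓ ≤ 2 ^ m₂ := by
      calc 160 * 2 ^ ℓ * 2 ^ prmKK s ℓ ≤ 2 ^ 8 * 2 ^ ℓ * 2 ^ prmKK s ℓ := Nat.mul_le_mul (Nat.mul_le_mul (by norm_num) le_rfl) le_rfl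
        _ = 2 ^ m₂ := by rw [← pow_add, ← pow_add, hm₂]
    have hR : (160 * 2 ^ ℓ * 2 ^ prmKK s ℓ : ℝ) ≤ 2 ^ m₂ := by exact_mod_cast hnat
    push_cast
    have hpos : (0 : ℝ) < 160 * 2 ^ ℓ * 2 ^ prmKK s ℓ := by positivity
    rw [show 1 / (10 * (2 : ℝ) ^ ℓ) / (4 * 2 ^ prmKK s ℓ) / 4 = 1 / (160 * 2 ^ ℓ * 2 ^ prmKK s ℓ) by field_simp; ring,
      mul_one_div, le_div_iff₀ hpos, one_mul]
    exact hR

/-- **`H3u`** with `δ₁ = 1/(2a)`. [cite: CarmosinoImpagliazzoKabanetsKolokolova2016, §5] -/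
theorem H3u_holds (ha : 1 ≤ a) :
    Real.exp (-(prmT (prmS n a b) ℓ * (1 / (10 * (2 ^ ℓ : ℕ)) / (4 * 2 ^ prmKK (prmS n a b) ℓ)) / 32)) ≤ 1 / (2 * a) / 16 := by
  obtain ⟨s, hs⟩ : ∃ s, prmS n a b = s := ⟨_, rfl⟩
  obtain ⟨κ, hκdef⟩ : ∃ κ, 3 * s + Nat.size ℓ + 30 = κ := ⟨_, rfl⟩
  have hkk : prmKK s ℓ = κ + 2 * ℓ + 8 := by rw [prmKK, prmKappa, hκdef]
  have hT : prmT s ℓ = 2 ^ (κ + 3 * ℓ + s + 22) := by rw [prmT, prmKappa, hκdef]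
  have has : a < 2 ^ s := hs ▸ a_lt_two_pow_prmS n a b
  have ha' : (0 : ℝ) < a := by exact_mod_cast ha
  rw [hs]
  obtain ⟨m₃, hm₃⟩ : ∃ m, 5 + s = m := ⟨_, rfl⟩
  apply exp_neg_le_of m₃
  · -- `m₃ ≤ t ε'/32`
    have hnat : m₃ * (1280 * 2 ^ ℓ * 2 ^ prmKK s ℓ) ≤ prmT s ℓ := by
      have h1 : m₃ ≤ 2 ^ (3 + s) := by
        have := succ_le_two_pow' s
        calc m₃ ≤ 8 * (s + 1) := by rw [← hm₃]; omega
          _ ≤ 2 ^ 3 * 2 ^ s := Nat.mul_le_mul (by norm_num) this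
          _ = 2 ^ (3 + s) := by rw [pow_add]
      calc m₃ * (1280 * 2 ^ ℓ * 2 ^ prmKK s ℓ) ≤ 2 ^ (3 + s) * (2 ^ 11 * 2 ^ ℓ * 2 ^ prmKK s ℓ) :=
            Nat.mul_le_mul h1 (Nat.mul_le_mul (Nat.mul_le_mul (by norm_num) le_rfl) le_rfl)
        _ = 2 ^ (κ + 3 * ℓ + s + 22) := by
            rw [← pow_add, ← pow_add, ← pow_add]; exact congrArg (fun e => 2 ^ e) (by rw [hkk]; omega)
        _ = prmT s ℓ := hT.symm
    have hR : (m₃ * (1280 * 2 ^ ℓ * 2 ^ prmKK s ℓ) : ℝ) ≤ prmT s ℓ := by exact_mod_cast hnat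
    push_cast at hR ⊢
    have hL : (0 : ℝ) < 2 ^ ℓ := by positivity
    have hP : (0 : ℝ) < 2 ^ prmKK s ℓ := by positivity
    generalize (prmT s ℓ : ℝ) = T at hR ⊢
    generalize (2 : ℝ) ^ ℓ = L at hR hL ⊢
    generalize (2 : ℝ) ^ prmKK s ℓ = P at hR hP ⊢
    rw [show T * (1 / (10 * L) / (4 * P)) / 32 = T / (1280 * L * P) by field_simp; ring, le_div_iff₀ (by positivity)]
    linarith
  · -- `1 ≤ 2^{m₃} · Y₃`
    have hnat : 32 * a ≤ 2 ^ m₃ := by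
      calc 32 * a ≤ 2 ^ 5 * 2 ^ s := Nat.mul_le_mul (by norm_num) has.le
        _ = 2 ^ m₃ := by rw [← pow_add, hm₃]
    have hR : (32 * a : ℝ) ≤ 2 ^ m₃ := by exact_mod_cast hnat
    rw [show (1 : ℝ) / (2 * a) / 16 = 1 / (32 * a) by field_simp; ring, mul_one_div, le_div_iff₀ (by positivity), one_mul]
    exact hR

/-- `e^{-k/8} ≤ 1/4`. [folklore] -/
theorem exp_neg_lvlK_le : Real.exp (-((lvlK n a b ℓ : ℝ) / 8)) ≤ 1 / 4 := by
  obtain ⟨κ, hκ⟩ : ∃ κ, prmKappa (prmS n a b) ℓ = κ := ⟨_, rfl⟩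
  have hK : (16 : ℝ) ≤ lvlK n a b ℓ := by
    have h30 : 30 ≤ κ := by rw [← hκ, prmKappa]; omega
    have : (2 : ℕ) ^ 4 ≤ 2 ^ κ := Nat.pow_le_pow_right (by norm_num) (by omega)
    have hKn : lvlK n a b ℓ = 2 ^ κ := by rw [lvlK, prmK, hκ]
    rw [hKn]; exact_mod_cast this
  refine exp_neg_le_of 2 ?_ (by norm_num)
  push_cast; linarith

/-- **`p₀` is not too small**: `(1/2)^{34+7ℓ+2κ} ≤ p₀`. [folklore] -/
theorem half_pow_le_pZero : (1 / 2 : ℝ) ^ (34 + 7 * ℓ + 2 * prmKappa (prmS n a b) ℓ) ≤ pZero n a b ℓ := by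
  obtain ⟨s, hs⟩ : ∃ s, prmS n a b = s := ⟨_, rfl⟩
  obtain ⟨κ, hκ⟩ : ∃ κ, prmKappa s ℓ = κ := ⟨_, rfl⟩
  have hkk : prmKK s ℓ = κ + 2 * ℓ + 8 := by rw [prmKK, hκ]
  have hexp := exp_neg_lvlK_le n a b ℓ
  rw [pZero, hs, hκ]
  -- `pZero ≥ (3/32) η ε'²`
  have hL : (0 : ℝ) < 2 ^ ℓ := by positivity
  have hP : (0 : ℝ) < 2 ^ prmKK s ℓ := by positivity
  have hnat : 512000 * 2 ^ (3 * ℓ) * 4 ^ prmKK s ℓ ≤ 3 * 2 ^ (34 + 7 * ℓ + 2 * κ) := by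
    calc 512000 * 2 ^ (3 * ℓ) * 4 ^ prmKK s ℓ ≤ (3 * 2 ^ 18) * 2 ^ (3 * ℓ) * 2 ^ (2 * prmKK s ℓ) := by
          rw [pow_mul (2 : ℕ) 2 (prmKK s ℓ), show (2 : ℕ) ^ 2 = 4 by norm_num]
          exact Nat.mul_le_mul (Nat.mul_le_mul (by norm_num) le_rfl) le_rfl
      _ = 3 * 2 ^ (34 + 7 * ℓ + 2 * κ) := by
          rw [mul_assoc, mul_assoc, ← pow_add, ← pow_add]; exact congrArg (fun e => 3 * 2 ^ e) (by rw [hkk]; omega)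
  have hR : (512000 * 2 ^ (3 * ℓ) * 4 ^ prmKK s ℓ : ℝ) ≤ 3 * 2 ^ (34 + 7 * ℓ + 2 * κ) := by exact_mod_cast hnat
  rw [show (4 : ℝ) ^ prmKK s ℓ = (2 ^ prmKK s ℓ) ^ 2 by rw [← pow_mul, mul_comm, pow_mul]; norm_num,
    show (2 : ℝ) ^ (3 * ℓ) = (2 ^ ℓ) ^ 3 by rw [← pow_mul, mul_comm]] at hR
  generalize (2 : ℝ) ^ ℓ = L at hL hR ⊢
  generalize (2 : ℝ) ^ prmKK s ℓ = P at hP hR ⊢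
  generalize (34 + 7 * ℓ + 2 * κ) = m at hR ⊢
  have h1 : (1 / 2 : ℝ) ≤ 1 - 2 * Real.exp (-((lvlK n a b ℓ : ℝ) / 8)) := by linarith
  have hε : (0 : ℝ) < 1 / (10 * L) / (4 * P) := by positivity
  calc (1 / 2 : ℝ) ^ m ≤ 1 / (10 * L) * (1 / (10 * L) / (4 * P)) * (3 * (1 / (10 * L) / (4 * P)) / 16 * (1 / 2)) := by
        rw [show 1 / (10 * L) * (1 / (10 * L) / (4 * P)) * (3 * (1 / (10 * L) / (4 * P)) / 16 * (1 / 2)) =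
          3 / (512000 * L ^ 3 * P ^ 2) by field_simp; ring]
        rw [one_div, inv_pow, ← one_div, div_le_div_iff₀ (by positivity) (by positivity), one_mul]
        linarith
    _ ≤ _ := by
        apply mul_le_mul_of_nonneg_left _ (by positivity)
        apply mul_le_mul_of_nonneg_left h1 (by positivity)

/-- `p₀ ≤ 1`. [folklore] -/
theorem pZero_le_one : pZero n a b ℓ ≤ 1 := by
  have hexp := exp_neg_lvlK_le n a b ℓ
  rw [pZero]
  have hL : (1 : ℝ) ≤ 2 ^ ℓ := one_le_pow₀ (by norm_num)
  have hP : (1 : ℝ) ≤ 2 ^ prmKK (prmS n a b) ℓ := one_le_pow₀ (by norm_num)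
  generalize (2 : ℝ) ^ ℓ = L at hL ⊢
  generalize (2 : ℝ) ^ prmKK (prmS n a b) ℓ = P at hP ⊢
  have hη : 1 / (10 * L) ≤ 1 := by rw [div_le_one (by positivity)]; linarith
  have hη0 : 0 ≤ 1 / (10 * L) := by positivity
  have hε : 1 / (10 * L) / (4 * P) ≤ 1 := by
    rw [div_le_one (by positivity)]; linarith
  have hε0 : 0 ≤ 1 / (10 * L) / (4 * P) := by positivity
  have hX : 3 * (1 / (10 * L) / (4 * P)) / 16 * (1 - 2 * Real.exp (-((lvlK n a b ℓ : ℝ) / 8))) ≤ 1 := by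
    have : 1 - 2 * Real.exp (-((lvlK n a b ℓ : ℝ) / 8)) ≤ 1 := by linarith [Real.exp_pos (-((lvlK n a b ℓ : ℝ) / 8))]
    have h0 : 0 ≤ 1 - 2 * Real.exp (-((lvlK n a b ℓ : ℝ) / 8)) := by linarith
    calc 3 * (1 / (10 * L) / (4 * P)) / 16 * (1 - 2 * Real.exp (-((lvlK n a b ℓ : ℝ) / 8))) ≤ 1 * 1 :=
          mul_le_mul (by linarith) this h0 (by norm_num)
      _ = 1 := by norm_num
  have hX0 : 0 ≤ 3 * (1 / (10 * L) / (4 * P)) / 16 * (1 - 2 * Real.exp (-((lvlK n a b ℓ : ℝ) / 8))) := by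
    apply mul_nonneg (by positivity); linarith
  calc 1 / (10 * L) * (1 / (10 * L) / (4 * P)) * (3 * (1 / (10 * L) / (4 * P)) / 16 * (1 - 2 * Real.exp (-((lvlK n a b ℓ : ℝ) / 8))))
      ≤ 1 * 1 * 1 := mul_le_mul (mul_le_mul hη hε hε0 (by norm_num)) hX hX0 (by norm_num)
    _ = 1 := by norm_num

/-- **The repetition bound**: `(1 - p₀)^{Reps} ≤ 1/(4b)`. [cite: CarmosinoImpagliazzoKabanetsKolokolova2016, §5] -/
theorem rep_bound (hb : 1 ≤ b) : (1 - pZero n a b ℓ) ^ prmReps (prmS n a b) ℓ ≤ 1 / (4 * b) := by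
  obtain ⟨s, hs⟩ : ∃ s, prmS n a b = s := ⟨_, rfl⟩
  obtain ⟨κ, hκ⟩ : ∃ κ, prmKappa s ℓ = κ := ⟨_, rfl⟩
  have hbs : b < 2 ^ s := hs ▸ b_lt_two_pow_prmS n a b
  have hReps : prmReps s ℓ = 2 ^ (2 * κ + 7 * ℓ + s + 40) := by rw [prmReps, hκ]
  have hp1 := half_pow_le_pZero n a b ℓ
  have hp2 := pZero_le_one n a b ℓ
  rw [hs, hκ] at hp1
  rw [hs, hReps]
  generalize pZero n a b ℓ = p at hp1 hp2 ⊢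
  obtain ⟨m, hm⟩ : ∃ m, 34 + 7 * ℓ + 2 * κ = m := ⟨_, rfl⟩
  rw [hm] at hp1
  have hb' : (0 : ℝ) < b := by exact_mod_cast hb
  -- `(1-p)^R ≤ (1 - 2^{-m})^R ≤ exp(-2^{-m} R) = exp(-2^{s+6})`
  have hq0 : (0 : ℝ) ≤ 1 - (1 / 2) ^ m := by
    have : (1 / 2 : ℝ) ^ m ≤ 1 := pow_le_one₀ (by norm_num) (by norm_num)
    linarith
  calc (1 - p) ^ 2 ^ (2 * κ + 7 * ℓ + s + 40) ≤ (1 - (1 / 2 : ℝ) ^ m) ^ 2 ^ (2 * κ + 7 * ℓ + s + 40) :=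
        pow_le_pow_left₀ (by linarith) (by linarith) _
    _ ≤ (Real.exp (-(1 / 2 : ℝ) ^ m)) ^ 2 ^ (2 * κ + 7 * ℓ + s + 40) :=
        pow_le_pow_left₀ hq0 (Real.one_sub_le_exp_neg _) _
    _ = Real.exp (-((2 : ℝ) ^ (s + 6))) := by
        rw [← Real.exp_nat_mul]
        refine congrArg Real.exp ?_
        rw [show 2 * κ + 7 * ℓ + s + 40 = m + (s + 6) by omega, pow_add]
        push_cast
        rw [one_div, inv_pow]
        field_simp
    _ ≤ 1 / (4 * b) := by
        refine exp_neg_le_of (s + 2) ?_ ?_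
        · have : s + 2 ≤ 2 ^ (s + 6) := by
            have := succ_le_two_pow' (s + 6); omega
          exact_mod_cast this
        · have : 4 * b ≤ 2 ^ (s + 2) := by rw [pow_add]; omega
          have hR : (4 * b : ℝ) ≤ 2 ^ (s + 2) := by exact_mod_cast this
          rw [mul_one_div, le_div_iff₀ (by positivity), one_mul]; exact hR

/-- **The validation bound, one level**: `Reps·2e^{-2m/(16a²)} ≤ (1/(4b))·(1/2)^{ℓ+1}`. [cite: CarmosinoImpagliazzoKabanetsKolokolova2016, §5] -/
theorem val_bound_level (ha : 1 ≤ a) (hb : 1 ≤ b) :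
    (prmReps (prmS n a b) ℓ : ℝ) * (2 * Real.exp (-2 * prmM (prmS n a b) ℓ * (1 / (4 * a)) ^ 2)) ≤
      1 / (4 * b) * (1 / 2) ^ (ℓ + 1) := by
  obtain ⟨s, hs⟩ : ∃ s, prmS n a b = s := ⟨_, rfl⟩
  obtain ⟨κ, hκ⟩ : ∃ κ, prmKappa s ℓ = κ := ⟨_, rfl⟩
  have has : a < 2 ^ s := hs ▸ a_lt_two_pow_prmS n a b
  have hbs : b < 2 ^ s := hs ▸ b_lt_two_pow_prmS n a b
  have hReps : prmReps s ℓ = 2 ^ (2 * κ + 7 * ℓ + s + 40) := by rw [prmReps, hκ]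
  obtain ⟨m₄, hm₄⟩ : ∃ m, 2 * κ + 8 * ℓ + 2 * s + 48 = m := ⟨_, rfl⟩
  have hM : prmM s ℓ = 64 * 4 ^ s * m₄ := by rw [prmM, hκ, hm₄]
  have ha' : (0 : ℝ) < a := by exact_mod_cast ha
  have hb' : (0 : ℝ) < b := by exact_mod_cast hb
  rw [hs]
  -- `exp(-2M/(16a²)) ≤ (1/2)^{m₄}`
  have hexp : Real.exp (-2 * prmM s ℓ * (1 / (4 * a)) ^ 2) ≤ (1 / 2) ^ m₄ := by
    rw [show -2 * (prmM s ℓ : ℝ) * (1 / (4 * a)) ^ 2 = -(prmM s ℓ / (8 * (a * a))) by field_simp; ring]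
    apply exp_neg_le_half_pow
    have hnat : m₄ * (8 * (a * a)) ≤ prmM s ℓ := by
      rw [hM]
      have haa : a * a ≤ 2 ^ s * 2 ^ s := Nat.mul_le_mul has.le has.le
      rw [show (4 : ℕ) ^ s = 2 ^ s * 2 ^ s by rw [← mul_pow]; norm_num]
      calc m₄ * (8 * (a * a)) ≤ m₄ * (8 * (2 ^ s * 2 ^ s)) := Nat.mul_le_mul_left _ (Nat.mul_le_mul_left _ haa)
        _ ≤ 64 * (2 ^ s * 2 ^ s) * m₄ := by rw [mul_comm]; exact Nat.mul_le_mul_right _ (Nat.mul_le_mul_right _ (by norm_num))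
    have hR : (m₄ * (8 * (a * a)) : ℝ) ≤ prmM s ℓ := by exact_mod_cast hnat
    rw [le_div_iff₀ (by positivity)]; exact hR
  -- bookkeeping
  have hnat : 2 ^ (2 * κ + 7 * ℓ + s + 40) * 2 * (2 ^ (ℓ + 1) * (4 * b)) ≤ 2 ^ m₄ := by
    calc 2 ^ (2 * κ + 7 * ℓ + s + 40) * 2 * (2 ^ (ℓ + 1) * (4 * b)) ≤ 2 ^ (2 * κ + 7 * ℓ + s + 40) * 2 * (2 ^ (ℓ + 1) * (4 * 2 ^ s)) :=
          Nat.mul_le_mul_left _ (Nat.mul_le_mul_left _ (Nat.mul_le_mul_left _ hbs.le))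
      _ = 2 ^ (2 * κ + 8 * ℓ + 2 * s + 44) := by
          rw [show (4 : ℕ) = 2 ^ 2 by norm_num, ← pow_succ, ← pow_add, ← pow_add, ← pow_add]
          exact congrArg (fun e => 2 ^ e) (by omega)
      _ ≤ 2 ^ m₄ := Nat.pow_le_pow_right (by norm_num) (by omega)
  have hR : (2 ^ (2 * κ + 7 * ℓ + s + 40) * 2 * (2 ^ (ℓ + 1) * (4 * b)) : ℝ) ≤ 2 ^ m₄ := by exact_mod_cast hnat
  rw [hReps]; push_cast
  have h2m : (0 : ℝ) < 2 ^ m₄ := by positivity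
  calc (2 : ℝ) ^ (2 * κ + 7 * ℓ + s + 40) * (2 * Real.exp (-2 * prmM s ℓ * (1 / (4 * a)) ^ 2))
      ≤ 2 ^ (2 * κ + 7 * ℓ + s + 40) * (2 * (1 / 2) ^ m₄) := by gcongr
    _ ≤ 1 / (4 * b) * (1 / 2) ^ (ℓ + 1) := by
        rw [show (2 : ℝ) ^ (2 * κ + 7 * ℓ + s + 40) * (2 * (1 / 2) ^ m₄) = (2 ^ (2 * κ + 7 * ℓ + s + 40) * 2) / 2 ^ m₄ by
            rw [one_div, inv_pow]; ring,
          show 1 / (4 * (b : ℝ)) * (1 / 2) ^ (ℓ + 1) = 1 / (2 ^ (ℓ + 1) * (4 * b)) by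
            rw [one_div (2 : ℝ), inv_pow, ← one_div, one_div_mul_one_div, mul_comm],
          div_le_div_iff₀ h2m (by positivity), one_mul]
        exact hR

/-- **The validation bound**: `Σ_{ℓ ≤ ℓg} Reps(ℓ)·2e^{-2m(ℓ)/(16a²)} ≤ 1/(4b)`. [cite: CarmosinoImpagliazzoKabanetsKolokolova2016, §5] -/
theorem val_bound (ha : 1 ≤ a) (hb : 1 ≤ b) (ℓg : ℕ) :
    ∑ ℓ ∈ Finset.range (ℓg + 1), (prmReps (prmS n a b) ℓ : ℝ) * (2 * Real.exp (-2 * prmM (prmS n a b) ℓ * (1 / (4 * a)) ^ 2)) ≤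
      1 / (4 * b) := by
  have hb' : (0 : ℝ) < b := by exact_mod_cast hb
  calc ∑ ℓ ∈ Finset.range (ℓg + 1), (prmReps (prmS n a b) ℓ : ℝ) * (2 * Real.exp (-2 * prmM (prmS n a b) ℓ * (1 / (4 * a)) ^ 2))
      ≤ ∑ ℓ ∈ Finset.range (ℓg + 1), (1 / (4 * (b : ℝ)) * (1 / 2 : ℝ) ^ (ℓ + 1)) :=
        Finset.sum_le_sum fun ℓ _ => val_bound_level n a b ℓ ha hb
    _ = 1 / (4 * (b : ℝ)) * ((1 / 2 : ℝ) * ∑ ℓ ∈ Finset.range (ℓg + 1), (1 / 2 : ℝ) ^ ℓ) := by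
        rw [Finset.mul_sum, Finset.mul_sum]
        refine Finset.sum_congr rfl fun ℓ _ => ?_
        rw [pow_succ]; ring
    _ ≤ 1 / (4 * (b : ℝ)) * ((1 / 2 : ℝ) * 2) := by
        gcongr
        exact sum_geometric_two_le _
    _ = 1 / (4 * (b : ℝ)) := by ring

end Level

end Literature.Computability.Learning
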